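import Literature.Topology.FourManifolds.ClosedModelRelOrientation
import Literature.Topology.FourManifolds.RelFundamentalClassOfOrientation
import HarnessLib

/-!
# Every orientation of a connected boundary is induced: `(M, μ) = bW` for orientable `W`

Topic `Literature/Topology/FourManifolds` (fact seat of
`Literature.Topology.FourManifolds.HomotopySphere.exists_highlyConnected_of_mem_signatureSet`,
brick B7′: orientation bookkeeping after a surgery).  Kervaire–Milnor, *Groups of homotopy
spheres I* (1963), §2 ("`-M`") and §7 ("`Σ = bM`"); Hatcher, *Algebraic Topology* (2002), §3.3
p. 234 ("a connected orientable manifold has exactly two orientations") and p. 253 (relative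
fundamental classes).  For a null-cobordism `c : NullCobordism n M` of a closed connected
nonempty `M`, `n ≥ 1`:

* `boundaryOrientation_neg`, `HomologicalOrientation.comap_neg` — reversing a relative
  fundamental class reverses the induced boundary orientation;
* `NullCobordism.forall_exists_isOrientedBy_of_isRelFundamentalClass` — if `(W, ∂W)` has a relative
  fundamental class over `ℤ` then **every** `ℤ`-orientation `μ` of `M` is the boundary orientation
  of an orientation `μ'` of the closed model: `c.IsOrientedBy μ μ'` (use `w` or `-w`, `M` being
  connected; `NullCobordism.isOrientedBy_closedModelOrientation`);
* `NullCobordism.forall_exists_isOrientedBy_of_smoothOrientation` — the same from a smooth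
  orientation of `W` (`NullCobordism.exists_isRelFundamentalClass_of_smoothOrientation`).

(Contrast `NullCobordism.exists_isOrientedBy_of_isRelFundamentalClass` of
`ClosedModelOrientation.lean`: SOME `μ`, assuming an atlas on the closed model and `W` connected;
here EVERY `μ`, no atlas on `Ŵ`, `M` connected.)  So after replacing `W` by a surgered `W'` with
the same boundary (`boundary_surgered_eq`), the
oriented-boundary condition of `signatureSet` is recovered as soon as `W'` is (smoothly or
homologically) oriented.  Everything is proved; no definitions, no named facts.

## References

* M. Kervaire, J. Milnor, *Groups of homotopy spheres I*, Ann. of Math. 77 (1963), §2, §7.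
  [KervaireMilnorAnnals1963]
* A. Hatcher, *Algebraic Topology* (2002), §3.3 pp. 234, 253. [HatcherAT2002]
-/

noncomputable section

open scoped Manifold ContDiff Topology
open Set Function
open Literature.AlgebraicTopology.SingularHomology

universe u

namespace Literature.AlgebraicTopology.SingularHomology

/-- Transport along a homeomorphism commutes with reversal: `(-μ).comap e = -(μ.comap e)`.
[cite: HatcherAT2002, §3.3 p. 234] -/
theorem HomologicalOrientation.comap_neg {R : Type*} [CommRing R] {X Y : Type u}
    [TopologicalSpace X] [TopologicalSpace Y] {n : ℕ} (μ : HomologicalOrientation R X n)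
    (e : Y ≃ₜ X) :
    (-μ).comap e = -(μ.comap e) := by
  ext y
  simp [HomologicalOrientation.comap_localClass, HomologicalOrientation.neg_localClass, map_neg]

/-- Reversing a relative fundamental class reverses the induced boundary orientation:
`∂(-z)|ₓ = -(∂z|ₓ)`. [cite: HatcherAT2002, §3.3 p. 234] -/
theorem boundaryOrientation_neg (R : Type) [CommRing R] {n : ℕ} {W : Type} [TopologicalSpace W]
    [T2Space W] [ChartedSpace (EuclideanHalfSpace (n + 1)) W] (hn : n ≠ 0)
    {z : relativeSingularHomology R R W ((𝓡∂ (n + 1)).boundary W) (n + 1)}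
    (hz : IsRelFundamentalClass R ((𝓡∂ (n + 1)).boundary W) z) :
    boundaryOrientation R hn hz.neg = -(boundaryOrientation R hn hz) := by
  ext x
  simp [boundaryOrientation_localClass, HomologicalOrientation.neg_localClass, map_neg]

end Literature.AlgebraicTopology.SingularHomology

namespace Literature.Topology.FourManifolds

namespace NullCobordism

variable {n : ℕ} {M : Type} [TopologicalSpace M] [ChartedSpace (EuclideanSpace ℝ (Fin n)) M]
  [IsManifold (𝓡 n) ∞ M] [T2Space M] [CompactSpace M] [Nonempty M] [ConnectedSpace M]
  (c : NullCobordism.{0} n M)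

/-- **Every orientation of a connected boundary is a boundary orientation** (Kervaire–Milnor 1963,
§2, §7; Hatcher 2002, p. 234): if `(W, ∂W)` carries a relative fundamental class over `ℤ` and
`∂W ≅ M` is closed, connected, nonempty of dimension `n ≥ 1`, then for EVERY `ℤ`-orientation `μ`
of `M` there is an orientation `μ'` of the closed model `W ∪ cone(∂W)` with `(M, μ) = bW`
(`c.IsOrientedBy μ μ'`): `M` has exactly the two orientations `±(∂w moved to M)`, realised by
`w` and `-w`. [cite: KervaireMilnorAnnals1963, §2 ("-M") and §7 ("Σ = bM")] -/
theorem forall_exists_isOrientedBy_of_isRelFundamentalClass (hn : 1 ≤ n)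
    {w : relativeSingularHomology ℤ ℤ c.W ((𝓡∂ (n + 1)).boundary c.W) (n + 1)}
    (hw : IsRelFundamentalClass ℤ ((𝓡∂ (n + 1)).boundary c.W) w)
    (μ : HomologicalOrientation ℤ M n) :
    ∃ μ' : HomologicalOrientation ℤ (ClosedModel n c.W) (n + 1), c.IsOrientedBy μ μ' := by
  obtain ⟨m, rfl⟩ : ∃ m, n = m + 1 := ⟨n - 1, by omega⟩
  obtain ⟨κ⟩ := BoundaryData.nonempty_collar_of_compactSpace m c.W c.boundaryData
  rcases HomologicalOrientation.eq_or_eq_neg_of_connected_holds (X := M) μ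
      ((boundaryOrientation ℤ (by omega) hw).comap c.bdryHomeomorph) with h | h
  · refine ⟨c.closedModelOrientation κ ℤ hn hw, ?_⟩
    rw [h]
    exact c.isOrientedBy_closedModelOrientation κ hn hw
  · refine ⟨c.closedModelOrientation κ ℤ hn hw.neg, ?_⟩
    have h' : μ = (boundaryOrientation ℤ (by omega) hw.neg).comap c.bdryHomeomorph := by
      rw [boundaryOrientation_neg ℤ (by omega) hw, HomologicalOrientation.comap_neg, ← h]
    rw [h']
    exact c.isOrientedBy_closedModelOrientation κ hn hw.neg

/-- **A smoothly oriented null-cobordism is oriented by every orientation of its connected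
boundary**: from a smooth orientation of `W` (`n ≥ 1`, `M = ∂W` closed connected nonempty) and
any `ℤ`-orientation `μ` of `M`, oriented-boundary data `c.IsOrientedBy μ μ'`
(`NullCobordism.exists_isRelFundamentalClass_of_smoothOrientation`, Hatcher p. 253, then
`forall_exists_isOrientedBy_of_isRelFundamentalClass`). [cite: HatcherAT2002, §3.3 p. 253] -/
theorem forall_exists_isOrientedBy_of_smoothOrientation (hn : 1 ≤ n)
    (o : SmoothOrientation (𝓡∂ (n + 1)) c.W) (μ : HomologicalOrientation ℤ M n) :
    ∃ μ' : HomologicalOrientation ℤ (ClosedModel n c.W) (n + 1), c.IsOrientedBy μ μ' := by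
  obtain ⟨m, rfl⟩ : ∃ m, n = m + 1 := ⟨n - 1, by omega⟩
  obtain ⟨w, hw⟩ := c.exists_isRelFundamentalClass_of_smoothOrientation o
  exact c.forall_exists_isOrientedBy_of_isRelFundamentalClass hn hw μ

end NullCobordism

end Literature.Topology.FourManifolds
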